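import Summits.Ventures.LatticeQCDFlow.Scoring.InfiniteVolumeWilsonLoops2D
import Summits.Ventures.LatticeQCDFlow.Scoring.SUNOnePlaquettePlaquetteRange
import HarnessLib

/-!
# The exact non-abelian area law in two dimensions, V-m: the infinite-volume `SU(N)` theory — Wilson loops `P_N(β)^{RT}`, exact string tension `−log|P_N(β)|`, confinement for `N ≥ 2`, `β ≠ 0`

HONEST FRAMING: exact (Metropolis-corrected) sampling algorithms for lattice gauge theory;
figures of merit are autocorrelation/cost numbers at stated couplings and volumes; no
continuum-physics claim.

Venture `LatticeQCDFlow` (cell pub-lqcd), sub-topic `Scoring`; FANOUT row 5 (`s0-sun-a`), GEN-19.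
NEW WORK of the cell (placement rule).  The `SU(N)` twin of V-l (`InfiniteVolumeWilsonLoops2D`), in the
vocabulary of `Literature…QuantumLattice.WilsonLoops` (S12): for the fundamental representation
`fundamentalRep (Fin N)` of `SU(N)` and theory-2's torus Wilson states on `(ℤ/(L+1))²`:

* **`specialUnitary_rectExpectation_eq`** — every `N ≥ 1`, every real `β`, every infinite-volume limit point
  `μ`, `R, T ≥ 1`: `W_μ(R,T) = P_N(β)^{RT}`, `P_N(β)` the `SU(N)` one-plaquette plaquette
  (`= N⁻¹(log Σ_q det[I_{|q+i−j|}])′(β)`, GEN-17; `N = 2`: `I₂(2β)/I₁(2β)`);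
* `specialUnitary_plaquette_ne_zero_abs_lt_one` (`N ≥ 2`, `β ≠ 0`, from GEN-17 (c)'s `−1 < P_N < 1`, strict
  monotonicity and `P_N(0) = 0`), `specialUnitary_rectExpectation_eq_zero` (`β = 0`);
* **`specialUnitary_hasStaticPotential`** (`V(R) = −R log|P_N(β)|`, exactly linear),
  **`specialUnitary_hasStringTension`** / `…'` (`σ_N(β) = −log|P_N(β)|`, iterated and joint forms),
  **`specialUnitary_isConfining`**, `specialUnitary_hasAreaLawState` — `N ≥ 2`, `β ≠ 0`, every limit point;
* **`specialUnitary_infiniteVolume_confinement`** — the package for THE infinite-volume limit `μ_β` (V-k):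
  INFINITE-VOLUME TWO-DIMENSIONAL `SU(N)` LATTICE YANG–MILLS, `N ≥ 2`, CONFINES AT EVERY `β ≠ 0` WITH THE EXACT
  STRING TENSION `−log|P_N(β)|`.

(The tree's S14 fact `osterwalder_seiler_areaLaw` gives, for `SU(N)` in any `d ≥ 2`, an area law and a string
tension `≥ −log(Cβ)` at STRONG coupling only; here `d = 2`, all `β ≠ 0`, with equality.)
No `def`, nothing cited as a fact, 0 sorry.
-/

noncomputable section

open MeasureTheory Function Finset Filter Topology
open Literature.MathematicalPhysics.QuantumFieldTheory
open Literature.MathematicalPhysics.QuantumLattice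
open Summit.Ventures.LatticeQCDFlow.Theory2.Lattice
open Summit.Ventures.LatticeQCDFlow.Theory2.Lattice.TwoDim

namespace Summit.Ventures.LatticeQCDFlow.Scoring

/-- **THE WILSON LOOPS OF THE INFINITE-VOLUME 2-d `SU(N)` THEORY, EVERY `N ≥ 1`, EVERY REAL `β`**: for every
infinite-volume limit point `μ` and `R, T ≥ 1`, `W_μ(R,T) = P_N(β)^{RT}`. -/
theorem specialUnitary_rectExpectation_eq (N : ℕ) [NeZero N] (β : ℝ)
    {μ : Measure (LGConfig 2 (Matrix.specialUnitaryGroup (Fin N) ℂ))}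
    (hμ : μ ∈ infiniteVolumeLimitPoints (fundamentalRep (Fin N)) β) {R T : ℕ} (hR1 : 1 ≤ R) (hT1 : 1 ≤ T) :
    rectExpectation μ (fun g => normalisedCharacter N (fundamentalRep (Fin N) g)) 0 1 R T =
      ((∫ u, ((u : Matrix.specialUnitaryGroup (Fin N) ℂ) : Matrix (Fin N) (Fin N) ℂ).trace.re / N *
            Real.exp (-(β * ((N : ℝ) -
              ((u : Matrix.specialUnitaryGroup (Fin N) ℂ) : Matrix (Fin N) (Fin N) ℂ).trace.re)))
            ∂(haarProbability (Matrix.specialUnitaryGroup (Fin N) ℂ))) /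
          (∫ u, Real.exp (-(β * ((N : ℝ) -
              ((u : Matrix.specialUnitaryGroup (Fin N) ℂ) : Matrix (Fin N) (Fin N) ℂ).trace.re)))
            ∂(haarProbability (Matrix.specialUnitaryGroup (Fin N) ℂ)))) ^ (R * T) := by
  obtain ⟨Ls, hLs, hlim⟩ := hμ
  have hA := tendsto_wilsonExpectation_wilsonLoop (fundamentalRep (Fin N)) (continuous_fundamentalRep (Fin N))
    hlim R T
  have hB := (specialUnitary_tendsto_wilsonExpectation_loop N β hR1 hT1
    (fun L => (0 : Site 2 (L + 1)))).comp hLs.tendsto_atTop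
  exact tendsto_nhds_unique hA hB

/-- At `β = 0` every Wilson loop of every infinite-volume limit point of 2-d `SU(N)`, `N ≥ 2`, vanishes. -/
theorem specialUnitary_rectExpectation_eq_zero (N : ℕ) (hN : 2 ≤ N)
    {μ : Measure (LGConfig 2 (Matrix.specialUnitaryGroup (Fin N) ℂ))}
    (hμ : μ ∈ infiniteVolumeLimitPoints (fundamentalRep (Fin N)) 0) {R T : ℕ} (hR1 : 1 ≤ R) (hT1 : 1 ≤ T) :
    rectExpectation μ (fun g => normalisedCharacter N (fundamentalRep (Fin N) g)) 0 1 R T = 0 := by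
  haveI : NeZero N := ⟨by omega⟩
  rw [specialUnitary_rectExpectation_eq N 0 hμ hR1 hT1, specialUnitary_plaquette_zero N hN,
    zero_pow (Nat.mul_ne_zero (by omega) (by omega))]

/-- `P_N(β) ≠ 0` and `|P_N(β)| < 1` for `SU(N)`, `N ≥ 2`, `β ≠ 0`. -/
theorem specialUnitary_plaquette_ne_zero_abs_lt_one (N : ℕ) (hN : 2 ≤ N) {β : ℝ} (hβ : β ≠ 0) :
    (∫ u, ((u : Matrix.specialUnitaryGroup (Fin N) ℂ) : Matrix (Fin N) (Fin N) ℂ).trace.re / N *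
          Real.exp (-(β * ((N : ℝ) - ((u : Matrix.specialUnitaryGroup (Fin N) ℂ) :
            Matrix (Fin N) (Fin N) ℂ).trace.re))) ∂(haarProbability (Matrix.specialUnitaryGroup (Fin N) ℂ)))
      / (∫ u, Real.exp (-(β * ((N : ℝ) - ((u : Matrix.specialUnitaryGroup (Fin N) ℂ) :
          Matrix (Fin N) (Fin N) ℂ).trace.re))) ∂(haarProbability (Matrix.specialUnitaryGroup (Fin N) ℂ))) ≠ 0 ∧
    |(∫ u, ((u : Matrix.specialUnitaryGroup (Fin N) ℂ) : Matrix (Fin N) (Fin N) ℂ).trace.re / N *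
          Real.exp (-(β * ((N : ℝ) - ((u : Matrix.specialUnitaryGroup (Fin N) ℂ) :
            Matrix (Fin N) (Fin N) ℂ).trace.re))) ∂(haarProbability (Matrix.specialUnitaryGroup (Fin N) ℂ)))
      / (∫ u, Real.exp (-(β * ((N : ℝ) - ((u : Matrix.specialUnitaryGroup (Fin N) ℂ) :
          Matrix (Fin N) (Fin N) ℂ).trace.re))) ∂(haarProbability (Matrix.specialUnitaryGroup (Fin N) ℂ)))| < 1 := by
  haveI : NeZero N := ⟨by omega⟩
  refine ⟨?_, abs_lt.2 ⟨neg_one_lt_specialUnitary_plaquette N β, specialUnitary_plaquette_lt_one N hN β⟩⟩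
  rcases lt_or_gt_of_ne hβ with hlt | hgt
  · have h := strictMono_specialUnitary_plaquette N hN hlt
    dsimp only at h
    rw [specialUnitary_plaquette_zero N hN] at h
    exact h.ne
  · exact (specialUnitary_plaquette_pos N hN hgt).ne'

/-- **THE STATIC POTENTIAL OF INFINITE-VOLUME 2-d `SU(N)` IS EXACTLY LINEAR**, `V_μ(R) = −R log|P_N(β)|`
(`N ≥ 2`, `β ≠ 0`, every infinite-volume limit point, `R ≥ 1`). -/
theorem specialUnitary_hasStaticPotential (N : ℕ) (hN : 2 ≤ N) {β : ℝ} (hβ : β ≠ 0)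
    {μ : Measure (LGConfig 2 (Matrix.specialUnitaryGroup (Fin N) ℂ))}
    (hμ : μ ∈ infiniteVolumeLimitPoints (fundamentalRep (Fin N)) β) {R : ℕ} (hR1 : 1 ≤ R) :
    HasStaticPotential μ (fun g => normalisedCharacter N (fundamentalRep (Fin N) g)) R
      (-(R * Real.log |(∫ u, ((u : Matrix.specialUnitaryGroup (Fin N) ℂ) : Matrix (Fin N) (Fin N) ℂ).trace.re / N *
          Real.exp (-(β * ((N : ℝ) - ((u : Matrix.specialUnitaryGroup (Fin N) ℂ) :
            Matrix (Fin N) (Fin N) ℂ).trace.re))) ∂(haarProbability (Matrix.specialUnitaryGroup (Fin N) ℂ)))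
      / (∫ u, Real.exp (-(β * ((N : ℝ) - ((u : Matrix.specialUnitaryGroup (Fin N) ℂ) :
          Matrix (Fin N) (Fin N) ℂ).trace.re))) ∂(haarProbability (Matrix.specialUnitaryGroup (Fin N) ℂ)))|)) := by
  haveI : NeZero N := ⟨by omega⟩
  exact hasStaticPotential_of_rectExpectation_eq_pow (specialUnitary_plaquette_ne_zero_abs_lt_one N hN hβ).1 R
    fun _ hT => specialUnitary_rectExpectation_eq N β hμ hR1 hT

/-- **THE STRING TENSION OF INFINITE-VOLUME 2-d `SU(N)` LATTICE YANG–MILLS EXISTS AND EQUALS `−log|P_N(β)|`**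
(`N ≥ 2`, `β ≠ 0`, every infinite-volume limit point; iterated form). -/
theorem specialUnitary_hasStringTension (N : ℕ) (hN : 2 ≤ N) {β : ℝ} (hβ : β ≠ 0)
    {μ : Measure (LGConfig 2 (Matrix.specialUnitaryGroup (Fin N) ℂ))}
    (hμ : μ ∈ infiniteVolumeLimitPoints (fundamentalRep (Fin N)) β) :
    HasStringTension μ (fun g => normalisedCharacter N (fundamentalRep (Fin N) g))
      (-Real.log |(∫ u, ((u : Matrix.specialUnitaryGroup (Fin N) ℂ) : Matrix (Fin N) (Fin N) ℂ).trace.re / N *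
          Real.exp (-(β * ((N : ℝ) - ((u : Matrix.specialUnitaryGroup (Fin N) ℂ) :
            Matrix (Fin N) (Fin N) ℂ).trace.re))) ∂(haarProbability (Matrix.specialUnitaryGroup (Fin N) ℂ)))
      / (∫ u, Real.exp (-(β * ((N : ℝ) - ((u : Matrix.specialUnitaryGroup (Fin N) ℂ) :
          Matrix (Fin N) (Fin N) ℂ).trace.re))) ∂(haarProbability (Matrix.specialUnitaryGroup (Fin N) ℂ)))|) := by
  haveI : NeZero N := ⟨by omega⟩
  exact hasStringTension_of_rectExpectation_eq_pow (specialUnitary_plaquette_ne_zero_abs_lt_one N hN hβ).1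
    fun _ _ hR hT => specialUnitary_rectExpectation_eq N β hμ hR hT

/-- The joint-limit form of the string tension for infinite-volume 2-d `SU(N)` (`N ≥ 2`, `β ≠ 0`). -/
theorem specialUnitary_hasStringTension' (N : ℕ) (hN : 2 ≤ N) {β : ℝ} (hβ : β ≠ 0)
    {μ : Measure (LGConfig 2 (Matrix.specialUnitaryGroup (Fin N) ℂ))}
    (hμ : μ ∈ infiniteVolumeLimitPoints (fundamentalRep (Fin N)) β) :
    HasStringTension' μ (fun g => normalisedCharacter N (fundamentalRep (Fin N) g))
      (-Real.log |(∫ u, ((u : Matrix.specialUnitaryGroup (Fin N) ℂ) : Matrix (Fin N) (Fin N) ℂ).trace.re / N *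
          Real.exp (-(β * ((N : ℝ) - ((u : Matrix.specialUnitaryGroup (Fin N) ℂ) :
            Matrix (Fin N) (Fin N) ℂ).trace.re))) ∂(haarProbability (Matrix.specialUnitaryGroup (Fin N) ℂ)))
      / (∫ u, Real.exp (-(β * ((N : ℝ) - ((u : Matrix.specialUnitaryGroup (Fin N) ℂ) :
          Matrix (Fin N) (Fin N) ℂ).trace.re))) ∂(haarProbability (Matrix.specialUnitaryGroup (Fin N) ℂ)))|) := by
  haveI : NeZero N := ⟨by omega⟩
  exact hasStringTension'_of_rectExpectation_eq_pow (specialUnitary_plaquette_ne_zero_abs_lt_one N hN hβ).1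
    fun _ _ hR hT => specialUnitary_rectExpectation_eq N β hμ hR hT

/-- **INFINITE-VOLUME TWO-DIMENSIONAL `SU(N)` LATTICE YANG–MILLS CONFINES AT EVERY `β ≠ 0`** (`N ≥ 2`, every
infinite-volume limit point). -/
theorem specialUnitary_isConfining (N : ℕ) (hN : 2 ≤ N) {β : ℝ} (hβ : β ≠ 0)
    {μ : Measure (LGConfig 2 (Matrix.specialUnitaryGroup (Fin N) ℂ))}
    (hμ : μ ∈ infiniteVolumeLimitPoints (fundamentalRep (Fin N)) β) :
    IsConfining μ (fun g => normalisedCharacter N (fundamentalRep (Fin N) g)) := by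
  haveI : NeZero N := ⟨by omega⟩
  exact isConfining_of_rectExpectation_eq_pow (specialUnitary_plaquette_ne_zero_abs_lt_one N hN hβ).1
    (specialUnitary_plaquette_ne_zero_abs_lt_one N hN hβ).2
    fun _ _ hR hT => specialUnitary_rectExpectation_eq N β hμ hR hT

/-- The infinite-volume 2-d `SU(N)` state obeys the area law with `C = 1`, `c = −log|P_N(β)| > 0`
(`N ≥ 2`, `β ≠ 0`). -/
theorem specialUnitary_hasAreaLawState (N : ℕ) (hN : 2 ≤ N) {β : ℝ} (hβ : β ≠ 0)
    {μ : Measure (LGConfig 2 (Matrix.specialUnitaryGroup (Fin N) ℂ))}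
    (hμ : μ ∈ infiniteVolumeLimitPoints (fundamentalRep (Fin N)) β) :
    HasAreaLawState μ (fun g => normalisedCharacter N (fundamentalRep (Fin N) g)) := by
  haveI : NeZero N := ⟨by omega⟩
  exact hasAreaLawState_of_rectExpectation_eq_pow (specialUnitary_plaquette_ne_zero_abs_lt_one N hN hβ).1
    (specialUnitary_plaquette_ne_zero_abs_lt_one N hN hβ).2
    fun _ _ hR hT => specialUnitary_rectExpectation_eq N β hμ hR hT

/-- **CONFINEMENT OF INFINITE-VOLUME TWO-DIMENSIONAL `SU(N)` LATTICE YANG–MILLS — THE PACKAGE** (`N ≥ 2`,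
every real `β ≠ 0`): the infinite-volume limit `μ_β` exists and is the unique limit point, `W(R,T) = P_N(β)^{RT}`,
the state confines with exact string tension `−log|P_N(β)| > 0` (iterated and joint forms), area law with `C = 1`. -/
theorem specialUnitary_infiniteVolume_confinement (N : ℕ) (hN : 2 ≤ N) {β : ℝ} (hβ : β ≠ 0) :
    ∃ μ : Measure (LGConfig 2 (Matrix.specialUnitaryGroup (Fin N) ℂ)),
      Literature.MathematicalPhysics.QuantumLattice.IsInfiniteVolumeLimit (fundamentalRep (Fin N)) β μ ∧
      infiniteVolumeLimitPoints (fundamentalRep (Fin N)) β = {μ} ∧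
      (∀ R T : ℕ, 1 ≤ R → 1 ≤ T →
        rectExpectation μ (fun g => normalisedCharacter N (fundamentalRep (Fin N) g)) 0 1 R T =
          ((∫ u, ((u : Matrix.specialUnitaryGroup (Fin N) ℂ) : Matrix (Fin N) (Fin N) ℂ).trace.re / N *
                Real.exp (-(β * ((N : ℝ) -
                  ((u : Matrix.specialUnitaryGroup (Fin N) ℂ) : Matrix (Fin N) (Fin N) ℂ).trace.re)))
                ∂(haarProbability (Matrix.specialUnitaryGroup (Fin N) ℂ))) /
              (∫ u, Real.exp (-(β * ((N : ℝ) -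
                  ((u : Matrix.specialUnitaryGroup (Fin N) ℂ) : Matrix (Fin N) (Fin N) ℂ).trace.re)))
                ∂(haarProbability (Matrix.specialUnitaryGroup (Fin N) ℂ)))) ^ (R * T)) ∧
      IsConfining μ (fun g => normalisedCharacter N (fundamentalRep (Fin N) g)) ∧
      HasStringTension μ (fun g => normalisedCharacter N (fundamentalRep (Fin N) g))
        (-Real.log |(∫ u, ((u : Matrix.specialUnitaryGroup (Fin N) ℂ) : Matrix (Fin N) (Fin N) ℂ).trace.re / N *
            Real.exp (-(β * ((N : ℝ) - ((u : Matrix.specialUnitaryGroup (Fin N) ℂ) :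
              Matrix (Fin N) (Fin N) ℂ).trace.re))) ∂(haarProbability (Matrix.specialUnitaryGroup (Fin N) ℂ)))
        / (∫ u, Real.exp (-(β * ((N : ℝ) - ((u : Matrix.specialUnitaryGroup (Fin N) ℂ) :
            Matrix (Fin N) (Fin N) ℂ).trace.re))) ∂(haarProbability (Matrix.specialUnitaryGroup (Fin N) ℂ)))|) ∧
      HasStringTension' μ (fun g => normalisedCharacter N (fundamentalRep (Fin N) g))
        (-Real.log |(∫ u, ((u : Matrix.specialUnitaryGroup (Fin N) ℂ) : Matrix (Fin N) (Fin N) ℂ).trace.re / N *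
            Real.exp (-(β * ((N : ℝ) - ((u : Matrix.specialUnitaryGroup (Fin N) ℂ) :
              Matrix (Fin N) (Fin N) ℂ).trace.re))) ∂(haarProbability (Matrix.specialUnitaryGroup (Fin N) ℂ)))
        / (∫ u, Real.exp (-(β * ((N : ℝ) - ((u : Matrix.specialUnitaryGroup (Fin N) ℂ) :
            Matrix (Fin N) (Fin N) ℂ).trace.re))) ∂(haarProbability (Matrix.specialUnitaryGroup (Fin N) ℂ)))|) ∧
      HasAreaLawState μ (fun g => normalisedCharacter N (fundamentalRep (Fin N) g)) := by
  haveI : NeZero N := ⟨by omega⟩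
  obtain ⟨μ, -, hlimit, huniq, -, -⟩ := exists_infiniteVolumeLimit_two (fundamentalRep (Fin N))
    (continuous_fundamentalRep (Fin N)) β
  have hμ : μ ∈ infiniteVolumeLimitPoints (fundamentalRep (Fin N)) β := hlimit.mem_infiniteVolumeLimitPoints
  exact ⟨μ, hlimit, huniq, fun R T hR hT => specialUnitary_rectExpectation_eq N β hμ hR hT,
    specialUnitary_isConfining N hN hβ hμ, specialUnitary_hasStringTension N hN hβ hμ,
    specialUnitary_hasStringTension' N hN hβ hμ, specialUnitary_hasAreaLawState N hN hβ hμ⟩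

end Summit.Ventures.LatticeQCDFlow.Scoring
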